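import Mathlib
import Summits.Ventures.PercRepro2.SwOutNeverCore
import Summits.Ventures.PercRepro2.SwOutArmAsym

/-!
# The never-core criterion on the asymmetric side (blind cell PercRepro2, night-4 g30,
2026-08-28; proofs/NIGHT4-G30.md §7)

g28's core-free criteria (`NeverCore`: an outside edge, no edge, the mark, separation from `h` by
one edge of `G[U]`, separation by a never-core vertex) enter the conditioning `Q` only through the
mark — `o ∈ C_R(l)` makes a core at `o` join `h` to `l`.  On the asymmetric side
`T(𝓤₁, 𝓤₂) = {h ∉ H_l, C_R(l) ∈ 𝓤₁, C_B(l) ∉ 𝓤₂}` the same role is played by every vertex FORCED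
into `C_R(l)` by `𝓤₁` (`∀ S ∈ 𝓤₁, x ∈ S`): `NeverCoreF` is the closure with the mark replaced by a
predicate `F` of forced vertices, `NeverCoreF.not_core2` the kernel fact, `rigidOK2_of_neverCoreF`
the class inequality (the arm principle on the asymmetric side, `rigidOK2_of_coreFree`), and
`card_le_asym_of_classes` glues the classes of the region `{l}ᶜ` into the whole-graph inequality:
**`swAll2_of_neverCoreF`** — the asymmetric domination on every graph whose vertices other than
`l, h` are never-core (with the forced vertices of `𝓤₁` in the mark's role), for every pair of
up-sets; `swAll2_of_bridges` is the bridge special case (g28's B9 class).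
-/

namespace Summit.Ventures.PercRepro2

namespace LocRows

open Hull

variable {V : Type*} {E : Type*} [Fintype E] [DecidableEq E]

open scoped Classical

variable {ends : E → Sym2 V}

section NeverCoreF

variable (ends) (U : Set V) (h : V) (F : V → Prop)

/-- **The vertices that are never a core, with a predicate `F` of forced vertices in the mark's
role**: the closure of «an outside edge», «no edge», «forced», «separated from `h` by one edge of
`G[U]`» under «separated from `h` by one vertex `w ≠ x, h` that is never a core». -/
inductive NeverCoreF : V → Prop
  | out (x : V) (e : E) (y : V) (hxy : ends e = s(x, y)) (hy : y ∉ U) : NeverCoreF x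
  | iso (x : V) (hx : ∀ e, x ∉ ends e) : NeverCoreF x
  | forced (x : V) (hx : F x) : NeverCoreF x
  | edge (x : V) (e₀ : E) (hx : x ∉ cluster ends (cutConfig ends U e₀) h) : NeverCoreF x
  | vertex (x w : V) (hw : NeverCoreF w) (hwx : w ≠ x) (hwh : w ≠ h)
      (hx : x ∉ cluster ends (avoidConfig ends U w) h) : NeverCoreF x

variable {ends U h F}

omit [Fintype E] in
/-- `NeverCore` with the mark `o` is `NeverCoreF` with `F = (· = o)`. -/
theorem NeverCore.neverCoreF {o x : V} (hN : NeverCore ends U h o x) :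
    NeverCoreF ends U h (· = o) x := by
  induction hN with
  | out x e y hxy hy => exact NeverCoreF.out x e y hxy hy
  | iso x hx => exact NeverCoreF.iso x hx
  | mark => exact NeverCoreF.forced o rfl
  | edge x e₀ hx => exact NeverCoreF.edge x e₀ hx
  | vertex x w _ hwx hwh hx ih => exact NeverCoreF.vertex x w ih hwx hwh hx

variable {l : V} {ξ : Config E} {𝓤₁ 𝓤₂ : Set (Set V)}

/-- **A `NeverCoreF` vertex other than `h` is in both clusters of `h` at no `T`-point of the
class**, when the forced vertices lie in every member of `𝓤₁`. -/
theorem NeverCoreF.not_core2 (hF : ∀ x, F x → ∀ S ∈ 𝓤₁, x ∈ S) {x : V}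
    (hN : NeverCoreF ends U h F x) (hxh : x ≠ h) {ζ : Config E}
    (hζ : ζ ∈ swOutSide2 ends l h 𝓤₁ 𝓤₂ U ξ) (hxT : x ∈ cluster ends ζ h)
    (hxTp : x ∈ cluster ends (blue ζ) h) : False := by
  have hQ := (mem_swOutSide2.1 hζ).1
  have hcl := (mem_swOutSide2.1 hζ).2
  have hT : cluster ends ζ h ⊆ U := fun y hy => (mem_outClass.1 hcl).2 (Or.inl hy)
  have hTp : cluster ends (blue ζ) h ⊆ U := fun y hy => (mem_outClass.1 hcl).2 (Or.inr hy)
  induction hN with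
  | out x e y hxy hyU =>
    cases he : ζ e with
    | true => exact hyU (hT (mem_cluster_of_edge hxT he hxy))
    | false =>
      have he' : blue ζ e = true := by rw [blue_eq_true_iff]; exact he
      exact hyU (hTp (mem_cluster_of_edge hxTp he' hxy))
  | iso x hiso =>
    obtain ⟨e, hxe⟩ := exists_edge_of_mem_cluster hxT hxh
    exact hiso e hxe
  | forced x hx =>
    rw [mem_tgtU2] at hQ
    simp only [hull, Set.mem_union, not_or] at hQ
    obtain ⟨⟨hhA, _⟩, hA, _⟩ := hQ
    exact hhA (conn_trans (hF x hx _ hA) (conn_symm hxT))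
  | edge x e₀ hx => exact not_core_of_cut (mem_outClass.1 hcl).2 hx hxT hxTp
  | vertex x w _ hwx hwh hx ih =>
    have hwT : w ∈ cluster ends ζ h := by
      by_contra hw
      exact hx (cluster_subset_cluster_avoid hT hw hxT)
    have hwTp : w ∈ cluster ends (blue ζ) h := by
      by_contra hw
      exact hx (cluster_subset_cluster_avoid hTp hw hxTp)
    exact ih hwh hwT hwTp

/-- **Every `T`-point of the class is core-free** when every vertex of `U ∖ {h}` is `NeverCoreF`. -/
theorem coreFree_of_neverCoreF (hF : ∀ x, F x → ∀ S ∈ 𝓤₁, x ∈ S)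
    (hN : ∀ x ∈ U, x ≠ h → NeverCoreF ends U h F x) {ζ : Config E}
    (hζ : ζ ∈ swOutSide2 ends l h 𝓤₁ 𝓤₂ U ξ) : CoreFree ends ζ h := by
  intro x hxT hxTp
  by_contra hxh
  have hcl := (mem_swOutSide2.1 hζ).2
  have hxU : x ∈ U := (mem_outClass.1 hcl).2 (Or.inl hxT)
  exact (hN x hxU hxh).not_core2 hF hxh hζ hxT hxTp

/-- **The rigid inequality on the asymmetric side of every class of a region whose vertices other
than `h` are `NeverCoreF`** (no loop at `h`). -/
theorem rigidOK2_of_neverCoreF (h𝓤₁ : IsUpperSet 𝓤₁) (h𝓤₂ : IsUpperSet 𝓤₂) (hl : l ∉ U)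
    (hloop : ∀ e, ends e ≠ s(h, h)) (hF : ∀ x, F x → ∀ S ∈ 𝓤₁, x ∈ S)
    (hN : ∀ x ∈ U, x ≠ h → NeverCoreF ends U h F x) {𝓔 : Set (Set E)} (h𝓔 : IsUpperSet 𝓔) :
    ((swOutSide2 ends l h 𝓤₁ 𝓤₂ U ξ).filter fun ζ => redEdges ends ζ h ∈ 𝓔).card ≤
      ((swOutSide2 ends l h 𝓤₁ 𝓤₂ U ξ).filter fun ζ => blueEdges ends ζ h ∈ 𝓔).card :=
  rigidOK2_of_coreFree h𝓤₁ h𝓤₂ hl hloop (fun _ hζ => coreFree_of_neverCoreF hF hN hζ) h𝓔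

end NeverCoreF

section Glue

variable {l h : V} {𝓤₁ 𝓤₂ : Set (Set V)}

/-- **Gluing the classes of the region `{l}ᶜ`**: the rigid counting inequality on the asymmetric
side of every class gives it on the whole side (the classes, indexed by `outRep`, partition `T`). -/
theorem card_le_asym_of_classes (hlh : l ≠ h)
    (hcls : ∀ ξ : Config E, ∀ 𝓔 : Set (Set E), IsUpperSet 𝓔 →
      ((swOutSide2 ends l h 𝓤₁ 𝓤₂ ({l}ᶜ) ξ).filter fun ζ => redEdges ends ζ h ∈ 𝓔).card ≤
        ((swOutSide2 ends l h 𝓤₁ 𝓤₂ ({l}ᶜ) ξ).filter fun ζ => blueEdges ends ζ h ∈ 𝓔).card)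
    (𝓔 : Set (Set E)) (h𝓔 : IsUpperSet 𝓔) :
    ((tgtU2 ends l h 𝓤₁ 𝓤₂).filter fun ζ => redEdges ends ζ h ∈ 𝓔).card ≤
      ((tgtU2 ends l h 𝓤₁ 𝓤₂).filter fun ζ => blueEdges ends ζ h ∈ 𝓔).card := by
  have _hlh := hlh
  set T := tgtU2 ends l h 𝓤₁ 𝓤₂ with hT
  let can : Config E → Config E := outRep ends ({l}ᶜ)
  have hmapR : ∀ ζ ∈ T.filter fun ζ => redEdges ends ζ h ∈ 𝓔, can ζ ∈ T.image can :=
    fun ζ hζ => Finset.mem_image_of_mem can (Finset.mem_filter.1 hζ).1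
  have hmapB : ∀ ζ ∈ T.filter fun ζ => blueEdges ends ζ h ∈ 𝓔, can ζ ∈ T.image can :=
    fun ζ hζ => Finset.mem_image_of_mem can (Finset.mem_filter.1 hζ).1
  rw [Finset.card_eq_sum_card_fiberwise hmapR, Finset.card_eq_sum_card_fiberwise hmapB]
  refine Finset.sum_le_sum fun ξ hξ => ?_
  obtain ⟨ζ₀, -, rfl⟩ := Finset.mem_image.1 hξ
  have hidem : ∀ ζ : Config E, outRep ends ({l}ᶜ) (outRep ends ({l}ᶜ) ζ) = outRep ends ({l}ᶜ) ζ := by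
    intro ζ; funext e; simp only [outRep]; split_ifs <;> rfl
  have hfib : ∀ P : Config E → Prop,
      (T.filter fun ζ => P ζ).filter (fun ζ => can ζ = can ζ₀) =
        (swOutSide2 ends l h 𝓤₁ 𝓤₂ ({l}ᶜ) (can ζ₀)).filter fun ζ => P ζ := by
    intro P
    ext ζ
    simp only [Finset.mem_filter, mem_swOutSide2, mem_outClass, hT]
    constructor
    · rintro ⟨⟨hζ, hP⟩, hcan⟩
      refine ⟨⟨hζ, ?_, ?_⟩, hP⟩
      · intro e he
        rw [← hcan]
        simp only [can, outRep, he, if_false]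
      · intro x hx hxl
        simp only [Set.mem_singleton_iff] at hxl
        subst hxl
        exact l_notMem_hull_of_mem_tgtU2 hζ hx
    · rintro ⟨⟨hζ, hagree, -⟩, hP⟩
      refine ⟨⟨hζ, hP⟩, ?_⟩
      show outRep ends ({l}ᶜ) ζ = outRep ends ({l}ᶜ) ζ₀
      rw [outRep_eq_of_agree (ends := ends) (U := {l}ᶜ) (ζ := outRep ends ({l}ᶜ) ζ₀) (ζ' := ζ) hagree,
        hidem]
  rw [hfib, hfib]
  exact hcls _ 𝓔 h𝓔

/-- **The asymmetric domination on every graph whose vertices other than `l, h` are `NeverCoreF`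
in the region `{l}ᶜ`**, the forced vertices of `𝓤₁` in the mark's role (no loop at `h`), for every
pair of up-sets. -/
theorem swAll2_of_neverCoreF {F : V → Prop} (hlh : l ≠ h) (hloop : ∀ e, ends e ≠ s(h, h))
    (h𝓤₁ : IsUpperSet 𝓤₁) (h𝓤₂ : IsUpperSet 𝓤₂) (hF : ∀ x, F x → ∀ S ∈ 𝓤₁, x ∈ S)
    (hN : ∀ x, x ≠ l → x ≠ h → NeverCoreF ends ({l}ᶜ) h F x) : SwAll2 ends l h 𝓤₁ 𝓤₂ := by
  refine exists_swAll_injection_of_card_le h _ (card_le_asym_of_classes hlh fun ξ 𝓔 h𝓔 => ?_)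
  exact rigidOK2_of_neverCoreF (ξ := ξ) h𝓤₁ h𝓤₂ (by simp) hloop hF
    (fun x hx hxh => hN x (by simpa using hx) hxh) h𝓔

/-- **The asymmetric domination on every graph with bridge junctions** (g28's class): every
vertex other than `l, h` is joined to `l`, or isolated, or forced by `𝓤₁`, or separated from `h`
by one edge of `G − l`. -/
theorem swAll2_of_bridges (hlh : l ≠ h) (hloop : ∀ e, ends e ≠ s(h, h))
    (h𝓤₁ : IsUpperSet 𝓤₁) (h𝓤₂ : IsUpperSet 𝓤₂)
    (hbr : ∀ x, x ≠ l → x ≠ h → (∀ S ∈ 𝓤₁, x ∈ S) ∨ (∃ e, ends e = s(x, l)) ∨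
      (∀ e, x ∉ ends e) ∨ ∃ e₀, x ∉ cluster ends (cutConfig ends ({l}ᶜ) e₀) h) :
    SwAll2 ends l h 𝓤₁ 𝓤₂ := by
  refine swAll2_of_neverCoreF (F := fun x => ∀ S ∈ 𝓤₁, x ∈ S) hlh hloop h𝓤₁ h𝓤₂
    (fun x hx => hx) fun x hxl hxh => ?_
  rcases hbr x hxl hxh with hf | ⟨e, he⟩ | hiso | ⟨e₀, hx⟩
  · exact NeverCoreF.forced x hf
  · exact NeverCoreF.out x e l he (by simp)
  · exact NeverCoreF.iso x hiso
  · exact NeverCoreF.edge x e₀ hx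

end Glue

end LocRows

end Summit.Ventures.PercRepro2
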